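import Literature.MathematicalPhysics.QuantumFieldTheory.Balaban1983to89.Beta.HessKerSchur

/-!
# `Balaban1983to89.Beta.HessKerSchurResolvent` — the SECOND RESOLVENT IDENTITY in the weighted Schur column class `ColW`:
# geometric convergence of the one-step OPERATORS ⟹ geometric convergence of their RESOLVENT KERNELS at the SAME rate and the SAME
# decay length (road A2 / (SW1) of the β sub-cell, CONSTANTS half; asymptotic lane asym1, gen 8, item 4, v1)

HONEST FRAMING (cell contract, verbatim): «discharging `BetaPertH` makes Bałaban's UV stability UNCONDITIONAL — a real
constructive-QFT result; it is NOT the continuum limit and NOT the Clay problem.»  THIS MODULE is [folklore] analysis on `ℤ^D`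
(Schur's test for a composition of two column-bounded kernels, the Kronecker kernel, the algebraic identity
`G − G′ = G·(H′ − H)·G′` for a left inverse `G` of `H` and a right inverse `G′` of `H′`); it formalises NO statement printed in Bałaban's
papers, cites none as a hypothesis, mints no `Prop` fact, instantiates NO binder of the wall (RULING (R18-3)) and DISCHARGES NOTHING of
it.  NOT summit progress.

ABSOLUTE RULE (cell, verbatim): «No internally-minted statement may enter as a cited fact. Every hypothesis is either
kernel-proved in this package or a verbatim quotation of a PUBLISHED theorem with page reference. The manuscript(s) under
audit are NOT citable for their own disputed steps — they are the thing under adjudication; programme-internal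
(2001/route/tribunal) claims are never citable.»  Every theorem below is kernel-proved from explicit, abstract hypotheses on
matrix-fibred kernels; nothing asserts that any kernel IS Bałaban's.

WHY THIS LEAF (budget bookkeeping, O-asym1-6; the (K-v) step of the template).  `HessKerSchur.geomRate_secondMoment_hessKer_primitivesW`
consumes, for the resolvent primitive, UNIFORM weighted column bounds `ColW (K j) R B_K`, `ColW K_∞ R B_K` and GEOMETRIC DEVIATIONS
`ColW (K j − K_∞) R (c_K θ^j)` — the latter is the resolvent form of (CONV-C) (AN2.md §6; OPEN, not in print).  In King's scalar template
the passage from convergence of the OPERATORS (his (K-ii)/(K-iii): symbols / averaging weights converge geometrically) to convergence of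
the COVARIANCES (his (K-v)) is done by interpolating a uniform decay bound against an unweighted rate bound, which returns the SQUARE
ROOT of the rate at HALF the decay length (tree: `King1986.CovarianceRate.abs_le_sqrt_mul_exp_half`).  In the weighted column class the
second resolvent identity does better and costs nothing: if `G_j` is a left inverse of `H_j`, `G_∞` a right inverse of `H_∞` (as
kernels on `ℤ^D`, compositions being the absolutely convergent series `ExpKernelCalculus.comp`), all four in `ColW` at rate `R > 0`
with uniform bounds `B_G`, `B_H`, and the OPERATORS converge in the weighted class, `ColW (H_∞ − H_j) R (c_H θ^j)`, then
`ColW (G_j − G_∞) R (B_G·c_H·B_G·θ^j)` — the SAME rate `θ` (not `√θ`) and the SAME decay length `R` (not `R/2`).  For road A2 this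
matters twice: `θ ↦ √θ` DOUBLES the certified finite range `k₁` that the one numeric condition `r < m − c₀ θ^{k₁}(1+θ)` demands, and
`R ↦ R/2` multiplies `c₀` through `M₂(R·N)` (memo ASYM-beta.md §3.6).  So the supplier-side content of (CONV-C) for the resolvent
primitive is REDUCED, inside the classes `HessKerSchur` consumes and with explicit constants, to: (i) uniform weighted column bounds
for `G_j`, `G_∞`, `H_j`, `H_∞` ((α)-type; Combes–Thomas, entering through `HessKerSchur.colW_of_decays` or `HessKerSchurL2.colW_of_colL2`),
(ii) the inverse relations, (iii) geometric convergence of the one-step OPERATORS in `ColW` — for finite-range operators with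
geometrically convergent coefficient tables an elementary estimate (`colW` of a finite-range kernel is a finite weighted sum of its
entries).  Nothing here says that Bałaban's objects satisfy (i)–(iii); that is supplier data (RULING (R25-1) units, AN2.md).

CONTENT.  §1 `colW_comp` — Schur's test for `comp A K` in `ColW` (same rate, constant `B_A·B_K`, no lattice constant; `0 ≤ R`), slice
summability `summable_slice` (`0 < R`), `colW_neg` / `colW_sub_comm`.  §2 the Kronecker kernel `idK` (`comp_idK_left/right`,
`colW_idK`).  §3 the second resolvent identity `resolvent_identity : G − G′ = comp (comp G (H′ − H)) G′` from `comp G H = idK`,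
`comp H′ G′ = idK` and `ColW` data at a rate `R > 0` (associativity and additivity of `comp` are CONDITIONAL on summability —
`KernelWard.comp_assoc_of_bound`, `comp_sub_left/right` — and the `ColW` data are exactly what discharges them).  §4 the rate brick
`colW_resolvent_sub` (constant `B_G·ε_H·B_G′`) and its family form `colW_resolvent_rate` (`B_G·c_H·B_G·θ^j`).  §5 the END corollaries
`geomRate_secondMoment_hessKer_operatorsW` / `oneLoopDrift_secondMoment_hessKer_operatorsW`: OPERATOR data in, `GeomRate` /
`OneLoopDrift` of the second moments of `hessKer (G j) (vertexOfK (G j) N (S j)) (W j)` at rate `R·N` out, resolvent deviation constant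
`c_K := B_G·c_H·B_G`.

RELATION TO THE TREE (no duplication): `KernelWard` §3–§4 prove additivity / associativity of `comp` under slice summability / product
majorants for bounded ∘ bi-localised configurations; `HessKerRate.comp_sub_comp` is the Lipschitz split of a composition in the POINTWISE
classes; `ResolventComposition(StepB)` (an5) are the structural layer-composition identities of specific block operators (finite
matrices), not rate statements; `King1986.CovarianceRate` is the scalar interpolation route.  The weighted-class Schur composition
`colW_comp` and the kernel-level resolvent identity on `ℤ^D` with its summability bookkeeping are new here.

WHAT IS NOT HERE (located, NOT in print, NOT claimed): the data (i)–(iii) for Bałaban's (rescaled) one-step operators and resolvents —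
(i) is (α)-type, (iii) is the operator form of (CONV-C) (OPEN, O-an2-2 / O-asym1-1, not in print); any numeric value of `B_G, B_H, c_H,
θ, R` for them.  NOT continuum, NOT Clay.
-/

open Finset Filter
open scoped BigOperators
open Literature.MathematicalPhysics.QuantumFieldTheory.Balaban1983to89
open Literature.MathematicalPhysics.QuantumFieldTheory.Balaban1983to89.Beta
open B12Sec2to5 (l1 l1_nonneg Decay510 betaPrime510)
open ExpKernelCalculus (MKer Decays VertexFamily₂ hessKer comp l1_sub_triangle summable_exp_shift summable_exp_shift')
open KernelWard (comp_sub_right comp_sub_left comp_assoc_of_bound)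
open HessKerSchur (RowW ColW VertexFamilyW VertexFamily₂W lipW LocStencilW sum_tsum_le abs_comp_mul_le abs_fibreSum_le
  geomRate_secondMoment_hessKer_primitivesW oneLoopDrift_secondMoment_hessKer_primitivesW)
open OneStepResolventKernel (Fib)
open OneStepKernelFamily (vertexOfK)

namespace Literature.MathematicalPhysics.QuantumFieldTheory.Balaban1983to89.Beta.HessKerSchurResolvent

noncomputable section

variable {D : ℕ} {F : Type*} [Fintype F]

/-! ## §1 Schur's test for a composition in the weighted column class -/

/-- Fibre-sum reordering: `Σ_{x∈s} Σ_a Σ_f P(x,a,f)·Q(f) = Σ_f (Σ_{x∈s} Σ_a P(x,a,f))·Q(f)`. [folklore] -/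
theorem sum_fibre_reorder (s : Finset (Fin D → ℤ)) (P : (Fin D → ℤ) → F → F → ℝ) (Q : F → ℝ) :
    ∑ x ∈ s, ∑ a, ∑ f, P x a f * Q f = ∑ f, (∑ x ∈ s, ∑ a, P x a f) * Q f := by
  symm
  calc ∑ f, (∑ x ∈ s, ∑ a, P x a f) * Q f = ∑ f, ∑ x ∈ s, ∑ a, P x a f * Q f := by
        refine Finset.sum_congr rfl fun f _ => ?_
        rw [Finset.sum_mul]
        exact Finset.sum_congr rfl fun x _ => Finset.sum_mul _ _ _
    _ = ∑ x ∈ s, ∑ f, ∑ a, P x a f * Q f := Finset.sum_comm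
    _ = ∑ x ∈ s, ∑ a, ∑ f, P x a f * Q f := Finset.sum_congr rfl fun x _ => Finset.sum_comm

/-- The weight triangle inequality `e^{R|x−z|₁} ≤ e^{R|x−y|₁}·e^{R|y−z|₁}` (`0 ≤ R`). [folklore] -/
theorem exp_weight_triangle {R : ℝ} (hR : 0 ≤ R) (x y z : Fin D → ℤ) :
    Real.exp (R * l1 (x - z)) ≤ Real.exp (R * l1 (x - y)) * Real.exp (R * l1 (y - z)) := by
  rw [← Real.exp_add, Real.exp_le_exp]
  have := mul_le_mul_of_nonneg_left (l1_sub_triangle x y z) hR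
  linarith

/-- An entry of a `ColW` kernel is bounded by the constant. [folklore] -/
theorem colW_abs_le {K : MKer D F} {R B : ℝ} (h : ColW K R B) (hR : 0 ≤ R) (x y : Fin D → ℤ) (a b : F) : |K x y a b| ≤ B := by
  have h1 := h.decays x y a b
  have h2 : Real.exp (-R * l1 (x - y)) ≤ 1 := by
    rw [Real.exp_le_one_iff]; nlinarith [l1_nonneg (x - y)]
  calc |K x y a b| ≤ B * Real.exp (-R * l1 (x - y)) := h1
    _ ≤ B * 1 := mul_le_mul_of_nonneg_left h2 h.nonneg
    _ = B := mul_one _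

/-- SLICE SUMMABILITY of the middle leg of `comp A K` from `ColW` data at a rate `R > 0` (majorant
`|F|·B_A·B_K·e^{−R|x−y|₁}`). [folklore] -/
theorem summable_slice {A K : MKer D F} {R BA BK : ℝ} (hA : ColW A R BA) (hK : ColW K R BK) (hR : 0 < R)
    (x z : Fin D → ℤ) (a b : F) : Summable fun y : Fin D → ℤ => ∑ f, A x y a f * K y z f b := by
  refine Summable.of_norm_bounded ((summable_exp_shift hR x).mul_left ((Fintype.card F : ℝ) * (BA * BK))) (fun y => ?_)
  rw [Real.norm_eq_abs]
  calc |∑ f, A x y a f * K y z f b| ≤ ∑ f, |A x y a f| * |K y z f b| := abs_fibreSum_le A K x y z a b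
    _ ≤ ∑ _f : F, BA * Real.exp (-R * l1 (x - y)) * BK := Finset.sum_le_sum fun f _ =>
        mul_le_mul (hA.decays x y a f) (colW_abs_le hK hR.le y z f b) (abs_nonneg _)
          (mul_nonneg hA.nonneg (Real.exp_pos _).le)
    _ = (Fintype.card F : ℝ) * (BA * BK) * Real.exp (-R * l1 (x - y)) := by
        rw [Finset.sum_const, Finset.card_univ, nsmul_eq_mul]; ring

/-- **SCHUR'S TEST IN `ColW`: `ColW A R B_A → ColW K R B_K → ColW (A ∘ K) R (B_A·B_K)`** — same rate, no lattice constant (`0 ≤ R`;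
the weight splits along the triangle inequality through the middle point). [folklore] -/
theorem colW_comp {A K : MKer D F} {R BA BK : ℝ} (hA : ColW A R BA) (hK : ColW K R BK) (hR : 0 ≤ R) :
    ColW (comp A K) R (BA * BK) := by
  classical
  refine ⟨mul_nonneg hA.nonneg hK.nonneg, fun z b s => ?_⟩
  -- the Schur majorant, indexed by `i = (x, a) ∈ s × F`
  let m : (Fin D → ℤ) × F → (Fin D → ℤ) → ℝ := fun i y =>
    ∑ f, |A i.1 y i.2 f| * Real.exp (R * l1 (i.1 - y)) * (|K y z f b| * Real.exp (R * l1 (y - z)))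
  have h0 : ∀ i y, 0 ≤ m i y := fun i y => Finset.sum_nonneg fun f _ => by positivity
  have hM : ∀ u : Finset (Fin D → ℤ), ∑ y ∈ u, ∑ i ∈ s ×ˢ (Finset.univ : Finset F), m i y ≤ BA * BK := by
    intro u
    calc ∑ y ∈ u, ∑ i ∈ s ×ˢ (Finset.univ : Finset F), m i y
        = ∑ y ∈ u, ∑ f, (∑ x ∈ s, ∑ a, |A x y a f| * Real.exp (R * l1 (x - y))) *
            (|K y z f b| * Real.exp (R * l1 (y - z))) := by
          refine Finset.sum_congr rfl fun y _ => ?_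
          rw [Finset.sum_product]
          exact sum_fibre_reorder s (fun x a f => |A x y a f| * Real.exp (R * l1 (x - y)))
            (fun f => |K y z f b| * Real.exp (R * l1 (y - z)))
      _ ≤ ∑ y ∈ u, ∑ f, BA * (|K y z f b| * Real.exp (R * l1 (y - z))) :=
          Finset.sum_le_sum fun y _ => Finset.sum_le_sum fun f _ =>
            mul_le_mul_of_nonneg_right (hA.2 y f s) (by positivity)
      _ = BA * ∑ y ∈ u, ∑ f, |K y z f b| * Real.exp (R * l1 (y - z)) := by
          rw [Finset.mul_sum]
          exact Finset.sum_congr rfl fun y _ => (Finset.mul_sum _ _ _).symm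
      _ ≤ BA * BK := mul_le_mul_of_nonneg_left (hK.2 z b u) hA.nonneg
  obtain ⟨hsum, hle⟩ := sum_tsum_le (s ×ˢ (Finset.univ : Finset F)) h0 hM
  calc ∑ x ∈ s, ∑ a, |comp A K x z a b| * Real.exp (R * l1 (x - z))
      ≤ ∑ x ∈ s, ∑ a, ∑' y, m (x, a) y := by
        refine Finset.sum_le_sum fun x hx => Finset.sum_le_sum fun a _ => ?_
        refine abs_comp_mul_le (Real.exp_pos _) (hsum (x, a) (Finset.mk_mem_product hx (Finset.mem_univ a))) fun y => ?_
        calc |∑ f, A x y a f * K y z f b| * Real.exp (R * l1 (x - z))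
            ≤ (∑ f, |A x y a f| * |K y z f b|) * (Real.exp (R * l1 (x - y)) * Real.exp (R * l1 (y - z))) :=
              mul_le_mul (abs_fibreSum_le A K x y z a b) (exp_weight_triangle hR x y z) (Real.exp_pos _).le
                (Finset.sum_nonneg fun f _ => by positivity)
          _ = m (x, a) y := by
              show _ = ∑ f, |A x y a f| * Real.exp (R * l1 (x - y)) * (|K y z f b| * Real.exp (R * l1 (y - z)))
              rw [Finset.sum_mul]
              exact Finset.sum_congr rfl fun f _ => by ring
    _ = ∑ i ∈ s ×ˢ (Finset.univ : Finset F), ∑' y, m i y := by rw [Finset.sum_product]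
    _ ≤ BA * BK := hle

/-- `ColW` is invariant under `K ↦ −K`. [folklore] -/
theorem colW_neg {K : MKer D F} {R B : ℝ} (h : ColW K R B) : ColW (-K) R B := by
  refine ⟨h.1, fun y b s => ?_⟩
  simpa only [Pi.neg_apply, abs_neg] using h.2 y b s

/-- `ColW (K − K′) R B → ColW (K′ − K) R B`. [folklore] -/
theorem colW_sub_comm {K K' : MKer D F} {R B : ℝ} (h : ColW (K - K') R B) : ColW (K' - K) R B := by
  have := colW_neg h
  rwa [neg_sub] at this

/-! ## §2 The Kronecker kernel -/

section IdK

variable [DecidableEq F]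

/-- The Kronecker (identity) kernel `δ_{x,y} δ_{a,b}`. [folklore] -/
def idK : MKer D F := fun x y a b => if x = y ∧ a = b then 1 else 0

omit [Fintype F] in
/-- Unfolding lemma for `idK`. [folklore] -/
theorem idK_apply (x y : Fin D → ℤ) (a b : F) : (idK : MKer D F) x y a b = if x = y ∧ a = b then 1 else 0 := rfl

omit [Fintype F] in
/-- The Kronecker kernel is its own absolute value. [folklore] -/
theorem abs_idK_apply (x y : Fin D → ℤ) (a b : F) : |(idK : MKer D F) x y a b| = if x = y ∧ a = b then 1 else 0 := by
  rw [idK_apply]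
  split_ifs <;> simp

/-- `idK ∘ K = K`. [folklore] -/
theorem comp_idK_left (K : MKer D F) : comp idK K = K := by
  funext x z a b
  show (∑' y, ∑ f, (idK : MKer D F) x y a f * K y z f b) = K x z a b
  rw [tsum_eq_single x]
  · simp [idK_apply]
  · intro y hy
    simp [idK_apply, Ne.symm hy]

/-- `K ∘ idK = K`. [folklore] -/
theorem comp_idK_right (K : MKer D F) : comp K idK = K := by
  funext x z a b
  show (∑' y, ∑ f, K x y a f * (idK : MKer D F) y z f b) = K x z a b
  rw [tsum_eq_single z]
  · simp [idK_apply]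
  · intro y hy
    simp [idK_apply, hy]

/-- `idK ∈ ColW` at every rate, constant `1`. [folklore] -/
theorem colW_idK (R : ℝ) : ColW (idK : MKer D F) R 1 := by
  refine ⟨zero_le_one, fun y b s => ?_⟩
  have hx : ∀ x, ∑ a, |(idK : MKer D F) x y a b| * Real.exp (R * l1 (x - y)) = if x = y then 1 else 0 := by
    intro x
    simp_rw [abs_idK_apply]
    by_cases hxy : x = y
    · subst hxy
      simp [l1]
    · simp [hxy]
  simp_rw [hx]
  rw [Finset.sum_ite_eq' s y]
  split_ifs <;> norm_num

end IdK

/-! ## §3 The second resolvent identity on `ℤ^D` -/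

section Resolvent

variable [DecidableEq F]

omit [DecidableEq F] in
/-- Product majorant for the triple `G ∘ H′ ∘ G′`: decay of `G` in its column leg, boundedness of `H′`, decay of `G′` in its row leg.
[folklore] -/
theorem triple_majorant {G H' G' : MKer D F} {R BG BH' BG' : ℝ} (hG : ColW G R BG) (hH' : ColW H' R BH') (hG' : ColW G' R BG')
    (hR : 0 < R) (x w : Fin D → ℤ) (a b : F) :
    ∃ φ ψ : (Fin D → ℤ) → ℝ, Summable φ ∧ Summable ψ ∧ (∀ y, 0 ≤ φ y) ∧ (∀ z, 0 ≤ ψ z) ∧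
      ∀ y z f g, |G x y a f * H' y z f g * G' z w g b| ≤ φ y * ψ z := by
  refine ⟨fun y => BG * BH' * Real.exp (-R * l1 (x - y)), fun z => BG' * Real.exp (-R * l1 (z - w)),
    ((summable_exp_shift hR x).mul_left _), ((summable_exp_shift' hR w).mul_left _),
    fun y => by have := hG.nonneg; have := hH'.nonneg; positivity, fun z => by have := hG'.nonneg; positivity,
    fun y z f g => ?_⟩
  rw [abs_mul, abs_mul]
  calc |G x y a f| * |H' y z f g| * |G' z w g b|
      ≤ BG * Real.exp (-R * l1 (x - y)) * BH' * (BG' * Real.exp (-R * l1 (z - w))) :=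
        mul_le_mul (mul_le_mul (hG.decays x y a f) (colW_abs_le hH' hR.le y z f g) (abs_nonneg _)
          (mul_nonneg hG.nonneg (Real.exp_pos _).le)) (hG'.decays z w g b) (abs_nonneg _)
          (mul_nonneg (mul_nonneg hG.nonneg (Real.exp_pos _).le) hH'.nonneg)
    _ = BG * BH' * Real.exp (-R * l1 (x - y)) * (BG' * Real.exp (-R * l1 (z - w))) := by ring

/-- **THE SECOND RESOLVENT IDENTITY** for kernels on `ℤ^D`: if `G` is a LEFT inverse of `H` (`G ∘ H = δ`) and `G′` a RIGHT inverse of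
`H′` (`H′ ∘ G′ = δ`), all four in `ColW` at a rate `R > 0`, then `G − G′ = G ∘ (H′ − H) ∘ G′` (compositions = the absolutely convergent
series `ExpKernelCalculus.comp`; the `ColW` data discharge the summability provisos of additivity and associativity). [folklore] -/
theorem resolvent_identity {G G' H H' : MKer D F} {R BG BG' BH BH' : ℝ} (hR : 0 < R)
    (hG : ColW G R BG) (hG' : ColW G' R BG') (hH : ColW H R BH) (hH' : ColW H' R BH')
    (hGH : comp G H = idK) (hH'G' : comp H' G' = idK) :
    G - G' = comp (comp G (H' - H)) G' := by
  have h1 : comp G (H' - H) = comp G H' - comp G H :=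
    comp_sub_right (summable_slice hG hH' hR) (summable_slice hG hH hR)
  have h2 : comp (comp G H' - comp G H) G' = comp (comp G H') G' - comp (comp G H) G' :=
    comp_sub_left (summable_slice (colW_comp hG hH' hR.le) hG' hR) (summable_slice (colW_comp hG hH hR.le) hG' hR)
  have h3 : comp (comp G H') G' = comp G (comp H' G') :=
    (comp_assoc_of_bound (triple_majorant hG hH' hG' hR)).symm
  rw [h1, h2, h3, hH'G', hGH, comp_idK_right, comp_idK_left]

/-! ## §4 The rate brick -/

/-- **RESOLVENT DIFFERENCES IN `ColW`**: under the hypotheses of `resolvent_identity`, `ColW (H′ − H) R ε_H` ⟹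
`ColW (G − G′) R (B_G·ε_H·B_G′)` — SAME rate `R`, LINEAR in `ε_H`. [folklore] -/
theorem colW_resolvent_sub {G G' H H' : MKer D F} {R BG BG' BH BH' εH : ℝ} (hR : 0 < R)
    (hG : ColW G R BG) (hG' : ColW G' R BG') (hH : ColW H R BH) (hH' : ColW H' R BH')
    (hGH : comp G H = idK) (hH'G' : comp H' G' = idK) (hε : ColW (H' - H) R εH) :
    ColW (G - G') R (BG * εH * BG') := by
  rw [resolvent_identity hR hG hG' hH hH' hGH hH'G']
  exact colW_comp (colW_comp hG hε hR.le) hG' hR.le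

/-- **THE RATE BRICK, family form.**  One-step OPERATORS `H j`, `H_∞` and RESOLVENT kernels `G j`, `G_∞` on `ℤ^D`, all in `ColW` at a
rate `R > 0` with uniform bounds, `G j` a left inverse of `H j`, `G_∞` a right inverse of `H_∞`, and the operators converging
geometrically IN THE WEIGHTED CLASS, `ColW (H_∞ − H j) R (c_H θ^j)` ⟹ `ColW (G j − G_∞) R (B_G·c_H·B_G·θ^j)`: the SAME rate `θ` and the
SAME decay length `R` (against `√θ` at `R/2` by decay/rate interpolation). [folklore] -/
theorem colW_resolvent_rate {G H : ℕ → MKer D F} {Ginf Hinf : MKer D F} {R BG BH cH θ : ℝ} (hR : 0 < R)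
    (hG : ∀ j, ColW (G j) R BG) (hGinf : ColW Ginf R BG) (hH : ∀ j, ColW (H j) R BH) (hHinf : ColW Hinf R BH)
    (hinv : ∀ j, comp (G j) (H j) = idK) (hinvinf : comp Hinf Ginf = idK)
    (hHrate : ∀ j, ColW (Hinf - H j) R (cH * θ ^ j)) (j : ℕ) :
    ColW (G j - Ginf) R (BG * cH * BG * θ ^ j) := by
  have h := colW_resolvent_sub hR (hG j) hGinf (hH j) hHinf (hinv j) hinvinf (hHrate j)
  rwa [show BG * (cH * θ ^ j) * BG = BG * cH * BG * θ ^ j by ring] at h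

/-- … with the operator deviations given as `ColW (H j − H_∞) R (c_H θ^j)`. [folklore] -/
theorem colW_resolvent_rate' {G H : ℕ → MKer D F} {Ginf Hinf : MKer D F} {R BG BH cH θ : ℝ} (hR : 0 < R)
    (hG : ∀ j, ColW (G j) R BG) (hGinf : ColW Ginf R BG) (hH : ∀ j, ColW (H j) R BH) (hHinf : ColW Hinf R BH)
    (hinv : ∀ j, comp (G j) (H j) = idK) (hinvinf : comp Hinf Ginf = idK)
    (hHrate : ∀ j, ColW (H j - Hinf) R (cH * θ ^ j)) (j : ℕ) :
    ColW (G j - Ginf) R (BG * cH * BG * θ ^ j) :=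
  colW_resolvent_rate hR hG hGinf hH hHinf hinv hinvinf (fun j => colW_sub_comm (hHrate j)) j

end Resolvent

/-! ## §5 END corollaries: operator data in, `GeomRate` / `OneLoopDrift` of the second moments out -/

section End

variable {d : ℕ}

/-- **END-TO-END FROM THE ONE-STEP OPERATORS.**  Resolvent kernels `G j`, `G_∞` and one-step operators `H j`, `H_∞` on `ℤ^{d+1}` with
fibre `Fib d`, all in `ColW` at rate `R > 0` (uniform bounds `B_G`, `B_H`), inverse relations `G j ∘ H j = δ`, `H_∞ ∘ G_∞ = δ`, operator
deviations `ColW (H_∞ − H j) R (c_H θ^j)`; stencil tables in `LocStencilW` at rate `R/2` and second-order vertices in `VertexFamily₂W` at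
rate `R` with their uniform bounds and geometric deviations (as in `HessKerSchur.geomRate_secondMoment_hessKer_primitivesW`); `1 ≤ N`
⟹ `RateCertificate.GeomRate` of the second moments of `hessKer (G j) (vertexOfK (G j) N (S j)) (W j)` at decay length `R·N`, with the
resolvent deviation constant `c_K := B_G·c_H·B_G`. [folklore] -/
theorem geomRate_secondMoment_hessKer_operatorsW {G H : ℕ → MKer (d + 1) (Fib d)} {Ginf Hinf : MKer (d + 1) (Fib d)}
    {S : ℕ → Fin (d + 1) → (Fin (d + 1) → ℤ) → MKer (d + 1) (Fib d)}
    {Sinf : Fin (d + 1) → (Fin (d + 1) → ℤ) → MKer (d + 1) (Fib d)}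
    {W : ℕ → Fin (d + 1) → (Fin (d + 1) → ℤ) → Fin (d + 1) → (Fin (d + 1) → ℤ) → MKer (d + 1) (Fib d)}
    {Winf : Fin (d + 1) → (Fin (d + 1) → ℤ) → Fin (d + 1) → (Fin (d + 1) → ℤ) → MKer (d + 1) (Fib d)}
    {R BG BH cH Bs cS BW cW θ : ℝ} {N : ℕ} (hR : 0 < R)
    (hG : ∀ j, ColW (G j) R BG) (hGinf : ColW Ginf R BG) (hH : ∀ j, ColW (H j) R BH) (hHinf : ColW Hinf R BH)
    (hinv : ∀ j, comp (G j) (H j) = idK) (hinvinf : comp Hinf Ginf = idK)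
    (hHrate : ∀ j, ColW (Hinf - H j) R (cH * θ ^ j))
    (hS : ∀ j, LocStencilW (S j) (R / 2) Bs) (hSinf : LocStencilW Sinf (R / 2) Bs)
    (hSrate : ∀ j, LocStencilW (S j - Sinf) (R / 2) (cS * θ ^ j))
    (hW : ∀ j, VertexFamily₂W (W j) N R BW) (hWinf : VertexFamily₂W Winf N R BW)
    (hWrate : ∀ j, VertexFamily₂W (W j - Winf) N R (cW * θ ^ j)) (hN : 1 ≤ N) (μ ν : Fin (d + 1)) :
    RateCertificate.GeomRate (fun j => B12Beta.secondMoment (hessKer (G j) (vertexOfK (G j) N (S j)) (W j)) μ ν)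
      (B12Beta.secondMoment (hessKer Ginf (vertexOfK Ginf N Sinf) Winf) μ ν)
      (betaPrime510 (d + 1)
        (lipW BG BG (BG * Bs) (BG * Bs) BW (BG * cH * BG) (BG * cH * BG * Bs + BG * cS) cW) (R * N)) θ :=
  geomRate_secondMoment_hessKer_primitivesW hG hGinf (colW_resolvent_rate hR hG hGinf hH hHinf hinv hinvinf hHrate)
    hS hSinf hSrate hW hWinf hWrate hR hN μ ν

/-- … and the road-A2 socket `Drift.OneLoopDrift`, defect `c₀/(1−θ)`. [folklore] -/
theorem oneLoopDrift_secondMoment_hessKer_operatorsW {G H : ℕ → MKer (d + 1) (Fib d)} {Ginf Hinf : MKer (d + 1) (Fib d)}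
    {S : ℕ → Fin (d + 1) → (Fin (d + 1) → ℤ) → MKer (d + 1) (Fib d)}
    {Sinf : Fin (d + 1) → (Fin (d + 1) → ℤ) → MKer (d + 1) (Fib d)}
    {W : ℕ → Fin (d + 1) → (Fin (d + 1) → ℤ) → Fin (d + 1) → (Fin (d + 1) → ℤ) → MKer (d + 1) (Fib d)}
    {Winf : Fin (d + 1) → (Fin (d + 1) → ℤ) → Fin (d + 1) → (Fin (d + 1) → ℤ) → MKer (d + 1) (Fib d)}
    {R BG BH cH Bs cS BW cW θ : ℝ} {N : ℕ} (hR : 0 < R)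
    (hG : ∀ j, ColW (G j) R BG) (hGinf : ColW Ginf R BG) (hH : ∀ j, ColW (H j) R BH) (hHinf : ColW Hinf R BH)
    (hinv : ∀ j, comp (G j) (H j) = idK) (hinvinf : comp Hinf Ginf = idK)
    (hHrate : ∀ j, ColW (Hinf - H j) R (cH * θ ^ j))
    (hS : ∀ j, LocStencilW (S j) (R / 2) Bs) (hSinf : LocStencilW Sinf (R / 2) Bs)
    (hSrate : ∀ j, LocStencilW (S j - Sinf) (R / 2) (cS * θ ^ j))
    (hW : ∀ j, VertexFamily₂W (W j) N R BW) (hWinf : VertexFamily₂W Winf N R BW)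
    (hWrate : ∀ j, VertexFamily₂W (W j - Winf) N R (cW * θ ^ j)) (hN : 1 ≤ N) (hθ0 : 0 ≤ θ) (hθ1 : θ < 1)
    (μ ν : Fin (d + 1)) :
    Drift.OneLoopDrift (B12Beta.secondMoment (hessKer Ginf (vertexOfK Ginf N Sinf) Winf) μ ν)
      (betaPrime510 (d + 1)
        (lipW BG BG (BG * Bs) (BG * Bs) BW (BG * cH * BG) (BG * cH * BG * Bs + BG * cS) cW) (R * N) / (1 - θ))
      (fun j => B12Beta.secondMoment (hessKer (G j) (vertexOfK (G j) N (S j)) (W j)) μ ν) :=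
  (geomRate_secondMoment_hessKer_operatorsW hR hG hGinf hH hHinf hinv hinvinf hHrate hS hSinf hSrate hW hWinf hWrate hN
    μ ν).drift hθ0 hθ1

end End

end

end Literature.MathematicalPhysics.QuantumFieldTheory.Balaban1983to89.Beta.HessKerSchurResolvent
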